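import Summits.QuantumFields.YangMills.Theorems.BalabanUVNodesK0Stub1FlatChartLineStationarity
import HarnessLib

/-!
# N07 (d′)-Lam, (R1) W1: k0-s1-w1's ♭-chart line stationarity with the criticality in CELL FORM (S4-Lam, first wrapper)

WHY (n07-e memo `LOCATED-DPRIME-CALIBRATION` §4 (R1), `DPRIME-LAM-ROADMAP` §2).  The head token of N07 (MODULE 100, `…N07Prop8StepTokenOfRecordDbarCprime`) displays the (158)
letters `hA1`; they are provable only from print's (ii)/cell-form criticality of the record's configuration ([15] (156)–(157): stationarity along curves keeping the
averages on the CELLS `Λ_j^{(j)}` of the family), which n07-e MODULES 101–104 transport to the meet family of a datum.  k0-s1's S4 chain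
(`exists_suReading_…_of_letters` → `socket127_flat_of_letters` → `exists_sectF_W_flatScaled_atRecord_socket` → `exists_letters10On_A1_of_flatSocket_T4` → n07-w4 `_nearTop`)
asks instead `IsCritOnFibre F N K 𝔹 …` for a determining set `𝔹` with `bondsOf 𝔹 ⊆ LamBonds` — strictly MORE than print's criticality (the fibre of a point set is cut by all
bonds inside it).  But k0-s1-w1's CORE `hasDerivAt_wilsonAction4_zero_of_flatChart_line_critical` already takes the cell form; this file re-cuts the two ∃-wrappers over it.

WHAT IS PROVED (sorry-free; no definition; axioms standard): ★★★ `exists_suReading_hasDerivAt_wilsonAction4_zero_critical_lam`, ★★★★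
`exists_suReading_hasDerivAt_wilsonAction4_zero_of_letters_lam` — k0-s1-w1 §3∕§4 with the binders `(𝔹) (h𝔹) (hcrit : IsCritOnFibre …)` replaced by the CORE's cell-form `hcrit`;
proofs cite k0-s1-w1 by name (`hasDerivAt_wilsonAction4_zero_of_flatChart_line_critical`, `exists_suReading_family`, `eventually_herm0_flatChart_line`,
`weightedBall_flatChart_of_letters`, `isLevWeight_one_nonneg`).
HONEST FRAMING: a re-cut of two wrappers, no new analysis; NOTHING of [15]'s estimates asserted; (d′) ∕ `HThm4RecDbar` ∕ budget row of MODULE 100 untouched; K0⁷ NOT closed;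
N07 NOT discharged; counts unmoved; one finite 𝕋⁴ programme at fixed ε — NOT continuum ∕ ℝ⁴ ∕ OS ∕ mass gap ∕ Clay.  No `sorry`, no `def`, no `instance`, no `notation`.

References: [15] = Balaban1985Variational (5)–(6) p.278, (44)–(49) p.285, (55) p.286, (127)–(128) p.297, (152) p.301, (156)–(157) p.302; Balaban1984PropagatorsII (2.3) p.224;
Balaban1988Convergent (2.10)–(2.12) p.256.
-/

set_option autoImplicit false

noncomputable section

open scoped BigOperators Matrix.Norms.L2Operator Topology ContDiff
open Filter

namespace Summit.QuantumFields.YangMills.BalabanUVNodes.N07FlatChartLineStationarityLam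

open Literature.MathematicalPhysics.QuantumFieldTheory.Balaban1983to89
open T4Continuum BlockAveraging ExpMeanLog
open T4Continuum (T4Family)
open B9AdOrthogonal (herm0)
open B15DeterminingSets (avgFamily)
open B6SectADomainsV1 (Domains)
open B6SectAOperatorsV1 (BondIdx)
open Node00 (avOfRecord)
open Summit.QuantumFields.YangMills.Theorems.Prop8Chart (expCfg)
open Summit.QuantumFields.YangMills.Theorems.Prop8ChartDoubleBar (chartLogFlat)
open Summit.QuantumFields.YangMills.Theorems.K0FlatCubeOpsTextP (IsLevWeight)
open Summit.QuantumFields.YangMills.Theorems.K0Stub1FlatChartLineStationarity (hasDerivAt_wilsonAction4_zero_of_flatChart_line_critical exists_suReading_family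
  eventually_herm0_flatChart_line weightedBall_flatChart_of_letters isLevWeight_one_nonneg)

section Transfer

variable (F : T4Family) (N : ℕ) [NeZero N] (K k : ℕ) (D : Domains (F.P K)) (hDk : D.k = k)
  (hcollar : ∀ (i : ℕ) (e : PBond (F.P K) (i + 1)), D.LamBond (i + 1) e → ∀ z : Site (F.P K) i, (blockOf z = e.src ∨ blockOf z = e.tgt) → z ∈ D.Om i)

/-! ## §1  The reading family supplied, criticality in cell form -/

include hDk hcollar in
/-- ★★★ **STATIONARITY WITH THE READING FAMILY SUPPLIED — CELL-FORM (Lam) EDITION** of k0-s1-w1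
`K0Stub1FlatChartLineStationarity.exists_suReading_hasDerivAt_wilsonAction4_zero_isCritOnFibre`: every letter VERBATIM (the ♭ chart's `H`, `Dsel`, (49)♭ `hfix`, the herm0 row,
the ball link, `A′₁` in the `ε₁`-ball, `δ ∈ ker Qlin♭`, both Hermitian-traceless, `U₀` reading `e^{iη(A′₁ − H·Dsel A′₁)}`), EXCEPT that the criticality of `U₀` is asked in the
CORE's cell form — stationarity of `𝔄` along every differentiable `SU(N)` curve through `U₀` keeping the averages `avgFamily (avOfRecord F N K) · j c` on the (2.3) CELLS
`D.LamBond j c`, `j ≤ k` (print's (ii)-reading of [15] (156)–(157); NO determining set `𝔹`, no `bondsOf 𝔹 ⊆ LamBonds` in-edge) ⟹ an `SU(N)` family `U` with `U 0 = U₀` reading the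
♭ chart line and **`(t ↦ 𝔄(U t))′(0) = 0`**.  Proof: k0-s1-w1's CORE `hasDerivAt_wilsonAction4_zero_of_flatChart_line_critical` + `exists_suReading_family`, cited by name.
[cite: Balaban1985Variational, (5)-(6) p.278, (47)-(49) p.285, (152) p.301, (156)-(157) p.302; Balaban1988Convergent, (2.10)-(2.12) p.256; Balaban1984PropagatorsII, (2.3) p.224] -/
theorem exists_suReading_hasDerivAt_wilsonAction4_zero_critical_lam {w : ℕ → PBond (F.P K) 0 → ℝ} (hw : IsLevWeight (F.P K) k D w) {R : ℝ} (hR0 : 0 ≤ R)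
    (hRL : 60800 * ((((F.P K).d + 2) * (F.P K).L : ℕ) : ℝ) ^ 2 * ((F.P K).L : ℝ) * R ≤ 1)
    (hguard : 60 * ((((F.P K).d + 2) * (F.P K).L : ℕ) : ℝ) ^ 2 * ((F.P K).L : ℝ) * R < deltaSU (Fin N))
    (H : (BondIdx D → Matrix (Fin N) (Fin N) ℂ) →ₗ[ℂ] (PBond (F.P K) 0 → Matrix (Fin N) (Fin N) ℂ))
    (Dsel : (PBond (F.P K) 0 → Matrix (Fin N) (Fin N) ℂ) → (BondIdx D → Matrix (Fin N) (Fin N) ℂ)) {ε ε₁ : ℝ} (hε₁ : ε₁ ≤ ε)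
    (hcd : ContDiffOn ℂ ω Dsel {Y : PBond (F.P K) 0 → Matrix (Fin N) (Fin N) ℂ | ∀ b, w 1 b * ‖Y b‖ < ε})
    (hfix : ∀ A' : PBond (F.P K) 0 → Matrix (Fin N) (Fin N) ℂ, (∀ b, w 1 b * ‖A' b‖ < ε) →
      chartLogFlat ((((F.P K).L : ℝ)⁻¹) ^ k) D (A' - H (Dsel A')) =
        (fderiv ℂ (chartLogFlat ((((F.P K).L : ℝ)⁻¹) ^ k) D :
          (PBond (F.P K) 0 → Matrix (Fin N) (Fin N) ℂ) → BondIdx D → Matrix (Fin N) (Fin N) ℂ) 0) A')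
    (hherm : ∀ A' : PBond (F.P K) 0 → Matrix (Fin N) (Fin N) ℂ, (∀ b, w 1 b * ‖A' b‖ < ε) → (∀ b, A' b ∈ herm0 (Fin N)) →
      (∀ i, Dsel A' i ∈ herm0 (Fin N)) ∧ ∀ b, (A' - H (Dsel A')) b ∈ herm0 (Fin N))
    (hchartball : ∀ A' : PBond (F.P K) 0 → Matrix (Fin N) (Fin N) ℂ, (∀ b, w 1 b * ‖A' b‖ < ε₁) → ∀ b, w 1 b * ‖(A' - H (Dsel A')) b‖ < R)
    (A₁ δ : PBond (F.P K) 0 → Matrix (Fin N) (Fin N) ℂ) (hA₁ : ∀ b, w 1 b * ‖A₁ b‖ < ε₁) (hA₁h : ∀ b, A₁ b ∈ herm0 (Fin N))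
    (hδ : (fderiv ℂ (chartLogFlat ((((F.P K).L : ℝ)⁻¹) ^ k) D :
      (PBond (F.P K) 0 → Matrix (Fin N) (Fin N) ℂ) → BondIdx D → Matrix (Fin N) (Fin N) ℂ) 0) δ = 0) (hδh : ∀ b, δ b ∈ herm0 (Fin N))
    (U₀ : GaugeField (F.P K) 0 (Matrix.specialUnitaryGroup (Fin N) ℂ))
    (hU₀ : ∀ b, ((U₀ b : Matrix.specialUnitaryGroup (Fin N) ℂ) : Matrix (Fin N) (Fin N) ℂ) =
      ((expCfg ((((F.P K).L : ℝ)⁻¹) ^ k) (A₁ - H (Dsel A₁)) b : (Matrix (Fin N) (Fin N) ℂ)ˣ) : _))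
    (hcrit : ∀ γ : ℝ → GaugeField (F.P K) 0 (Matrix.specialUnitaryGroup (Fin N) ℂ), γ 0 = U₀ →
      DifferentiableAt ℝ (fun (t : ℝ) (b : PBond (F.P K) 0) => ((γ t b : Matrix.specialUnitaryGroup (Fin N) ℂ) : Matrix (Fin N) (Fin N) ℂ)) 0 →
      (∀ (t : ℝ) (j : ℕ) (c : PBond (F.P K) j), j ≤ k → D.LamBond j c → avgFamily (avOfRecord F N K) (γ t) j c = avgFamily (avOfRecord F N K) U₀ j c) →
      HasDerivAt (fun t => wilsonAction4 (γ t)) 0 0) :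
    ∃ U : ℝ → GaugeField (F.P K) 0 (Matrix.specialUnitaryGroup (Fin N) ℂ), U 0 = U₀ ∧
      (∀ᶠ t : ℝ in 𝓝 0, ∀ b, ((U t b : Matrix.specialUnitaryGroup (Fin N) ℂ) : Matrix (Fin N) (Fin N) ℂ) =
        ((expCfg ((((F.P K).L : ℝ)⁻¹) ^ k) ((A₁ + (↑t : ℂ) • δ) - H (Dsel (A₁ + (↑t : ℂ) • δ))) b : (Matrix (Fin N) (Fin N) ℂ)ˣ) : _)) ∧
      HasDerivAt (fun t => wilsonAction4 (U t)) 0 0 := by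
  have hA₁ε : ∀ b, w 1 b * ‖A₁ b‖ < ε := fun b => (hA₁ b).trans_le hε₁
  have hAh := eventually_herm0_flatChart_line w ε H Dsel hherm A₁ δ hA₁ε hA₁h hδh
  obtain ⟨U, hU0, hU⟩ := exists_suReading_family ((((F.P K).L : ℝ)⁻¹) ^ k) (fun z => (A₁ + z • δ) - H (Dsel (A₁ + z • δ))) hAh U₀
    (fun b => by rw [hU₀ b, zero_smul, add_zero])
  refine ⟨U, hU0, hU, ?_⟩
  refine hasDerivAt_wilsonAction4_zero_of_flatChart_line_critical F N K k D hDk hcollar hw hR0 hRL hguard H Dsel hε₁ hcd hfix hchartball A₁ δ hA₁ hδ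
    U hU fun γ hγ0 hγd hγfib => ?_
  rw [hU0] at hγ0 hγfib
  exact hcrit γ hγ0 hγd hγfib

/-! ## §2  All letters, criticality in cell form — the S4-Lam chain's entry -/

include hDk hcollar in
/-- ★★★★ **ALL LETTERS, CELL-FORM (Lam) EDITION** of k0-s1-w1 `K0Stub1FlatChartLineStationarity.exists_suReading_hasDerivAt_wilsonAction4_zero_of_letters` (the assembler's
entry of the S4 chain): sup row of `H`, (55)♭, `ContDiffOn ℂ ω Dsel`, (49)♭, the herm0 row, `IsLevWeight` weights with `60800ℓ²LR ≤ 1`, `60ℓ²LR < δ_N`, `ε₁ ≤ ε`,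
`ε₁ + B_f·C_D·ε₁² ≤ R`, `A′₁`, `δ`, `U₀` as there — with the criticality of `U₀` in the CORE's cell form (see `exists_suReading_hasDerivAt_wilsonAction4_zero_critical_lam`)
instead of `IsCritOnFibre F N K 𝔹 …` for a determining set ⟹ **`∃ U, U 0 = U₀ ∧ (U t reads the ♭ chart line near 0) ∧ (t ↦ 𝔄(U t))′(0) = 0`**.
[cite: Balaban1985Variational, (5)-(6) p.278, (20) p.281, (44)-(49) p.285, (55) p.286, (127)-(128) p.297, (152) p.301, (156)-(157) p.302; Balaban1985Averaging, (92) p.31, (134) p.38; Balaban1984PropagatorsII, (2.3) p.224; Balaban1988Convergent, (2.10)-(2.12) p.256] -/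
theorem exists_suReading_hasDerivAt_wilsonAction4_zero_of_letters_lam {w : ℕ → PBond (F.P K) 0 → ℝ} (hw : IsLevWeight (F.P K) k D w) {R : ℝ} (hR0 : 0 ≤ R)
    (hRL : 60800 * ((((F.P K).d + 2) * (F.P K).L : ℕ) : ℝ) ^ 2 * ((F.P K).L : ℝ) * R ≤ 1)
    (hguard : 60 * ((((F.P K).d + 2) * (F.P K).L : ℕ) : ℝ) ^ 2 * ((F.P K).L : ℝ) * R < deltaSU (Fin N))
    (H : (BondIdx D → Matrix (Fin N) (Fin N) ℂ) →ₗ[ℂ] (PBond (F.P K) 0 → Matrix (Fin N) (Fin N) ℂ))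
    (Dsel : (PBond (F.P K) 0 → Matrix (Fin N) (Fin N) ℂ) → (BondIdx D → Matrix (Fin N) (Fin N) ℂ)) {ε ε₁ Bf CD : ℝ} (hε₁0 : 0 ≤ ε₁) (hε₁ : ε₁ ≤ ε)
    (hCD : 0 ≤ CD) (hwin : ε₁ + Bf * CD * ε₁ ^ 2 ≤ R)
    (hHB : ∀ (X : BondIdx D → Matrix (Fin N) (Fin N) ℂ) (t : ℝ), 0 ≤ t → (∀ c, ‖X c‖ ≤ t) → ∀ b, w 1 b * ‖H X b‖ ≤ Bf * t)
    (h55 : ∀ A' : PBond (F.P K) 0 → Matrix (Fin N) (Fin N) ℂ, (∀ b, w 1 b * ‖A' b‖ < ε) →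
      ∀ ρ' : ℝ, 0 ≤ ρ' → (∀ b, w 1 b * ‖A' b‖ ≤ ρ') → ∀ i : BondIdx D, ‖Dsel A' i‖ ≤ CD * ρ' ^ 2)
    (hcd : ContDiffOn ℂ ω Dsel {Y : PBond (F.P K) 0 → Matrix (Fin N) (Fin N) ℂ | ∀ b, w 1 b * ‖Y b‖ < ε})
    (hfix : ∀ A' : PBond (F.P K) 0 → Matrix (Fin N) (Fin N) ℂ, (∀ b, w 1 b * ‖A' b‖ < ε) →
      chartLogFlat ((((F.P K).L : ℝ)⁻¹) ^ k) D (A' - H (Dsel A')) =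
        (fderiv ℂ (chartLogFlat ((((F.P K).L : ℝ)⁻¹) ^ k) D :
          (PBond (F.P K) 0 → Matrix (Fin N) (Fin N) ℂ) → BondIdx D → Matrix (Fin N) (Fin N) ℂ) 0) A')
    (hherm : ∀ A' : PBond (F.P K) 0 → Matrix (Fin N) (Fin N) ℂ, (∀ b, w 1 b * ‖A' b‖ < ε) → (∀ b, A' b ∈ herm0 (Fin N)) →
      (∀ i, Dsel A' i ∈ herm0 (Fin N)) ∧ ∀ b, (A' - H (Dsel A')) b ∈ herm0 (Fin N))
    (A₁ δ : PBond (F.P K) 0 → Matrix (Fin N) (Fin N) ℂ) (hA₁ : ∀ b, w 1 b * ‖A₁ b‖ < ε₁) (hA₁h : ∀ b, A₁ b ∈ herm0 (Fin N))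
    (hδ : (fderiv ℂ (chartLogFlat ((((F.P K).L : ℝ)⁻¹) ^ k) D :
      (PBond (F.P K) 0 → Matrix (Fin N) (Fin N) ℂ) → BondIdx D → Matrix (Fin N) (Fin N) ℂ) 0) δ = 0) (hδh : ∀ b, δ b ∈ herm0 (Fin N))
    (U₀ : GaugeField (F.P K) 0 (Matrix.specialUnitaryGroup (Fin N) ℂ))
    (hU₀ : ∀ b, ((U₀ b : Matrix.specialUnitaryGroup (Fin N) ℂ) : Matrix (Fin N) (Fin N) ℂ) =
      ((expCfg ((((F.P K).L : ℝ)⁻¹) ^ k) (A₁ - H (Dsel A₁)) b : (Matrix (Fin N) (Fin N) ℂ)ˣ) : _))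
    (hcrit : ∀ γ : ℝ → GaugeField (F.P K) 0 (Matrix.specialUnitaryGroup (Fin N) ℂ), γ 0 = U₀ →
      DifferentiableAt ℝ (fun (t : ℝ) (b : PBond (F.P K) 0) => ((γ t b : Matrix.specialUnitaryGroup (Fin N) ℂ) : Matrix (Fin N) (Fin N) ℂ)) 0 →
      (∀ (t : ℝ) (j : ℕ) (c : PBond (F.P K) j), j ≤ k → D.LamBond j c → avgFamily (avOfRecord F N K) (γ t) j c = avgFamily (avOfRecord F N K) U₀ j c) →
      HasDerivAt (fun t => wilsonAction4 (γ t)) 0 0) :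
    ∃ U : ℝ → GaugeField (F.P K) 0 (Matrix.specialUnitaryGroup (Fin N) ℂ), U 0 = U₀ ∧
      (∀ᶠ t : ℝ in 𝓝 0, ∀ b, ((U t b : Matrix.specialUnitaryGroup (Fin N) ℂ) : Matrix (Fin N) (Fin N) ℂ) =
        ((expCfg ((((F.P K).L : ℝ)⁻¹) ^ k) ((A₁ + (↑t : ℂ) • δ) - H (Dsel (A₁ + (↑t : ℂ) • δ))) b : (Matrix (Fin N) (Fin N) ℂ)ˣ) : _)) ∧
      HasDerivAt (fun t => wilsonAction4 (U t)) 0 0 :=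
  exists_suReading_hasDerivAt_wilsonAction4_zero_critical_lam F N K k D hDk hcollar hw hR0 hRL hguard H Dsel hε₁ hcd hfix hherm
    (fun A' hA' b => weightedBall_flatChart_of_letters w (isLevWeight_one_nonneg hw) hε₁0 hε₁ hCD hwin H Dsel hHB h55 A' hA' b)
    A₁ δ hA₁ hA₁h hδ hδh U₀ hU₀ hcrit

end Transfer

end Summit.QuantumFields.YangMills.BalabanUVNodes.N07FlatChartLineStationarityLam

end
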